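import Literature.MathematicalPhysics.QuantumFieldTheory.Balaban1983to89.Node00.Record13NumericsOfThm1
import Literature.MathematicalPhysics.QuantumFieldTheory.Balaban1983to89.Node00.Record13BgRow

/-!
# NODE 00 (YM-PLAN Track A) — STAGE 13: K0‴(F) FROM [15] THEOREM 1 — (8) as node00-def-P11's named fact `VariationalThm1Scaled`, (9)–(10) as the two displayed
# gauge clauses — at the [15]-keyed witness `theta13OfThm1`: the COMPOSITION «socket ∘ supplier» with the letter inequalities discharged IN KERNEL

Cell `pub-ymgap`, seat `pub-ymgap-node00-def-K0a` (g4), FILE 10b (companion of FILE 10a `Node00/Record13NumericsOfThm1`: the [15]-keyed numerics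
`stage12NumericsOfThm1 ε₀ B₃ a₀ a₁`, the witness `theta13OfThm1 F N ε₀ ε₂₉ B₃ a₀ a₁` and the window ⇒ letter-inequality lemmas).  Trigger (t3) of the K0a lineage:
node00-def-P11's supplier `Node00/Record13BgRow` (`Stage13Params.bg_of_thm1Scaled`: the BODY of `Provisos₁₃.bg` from (h15) `VariationalThm1Scaled F N B₃ a₀ a₁` +
(ha₀) `εreg ≤ a₀` + (hnum) `0 < cR·ε_m ≤ a₁`, `B₃·cR·ε_m ≤ εreg` + (hBα) `B₃·cR·ε_m ≤ (1 − β)·α₀(g_m)` + the two gauge clauses (hloc) (1.12) [I], (h238) (2.38) [III])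
composed with the K0a socket `exists_k0_of_bg_theta13LiveOfNumerics` (FILE 9 `Node00/Record13LiveSelectorFamily` §3).  [I] = [Balaban1987RG1], [III] =
[Balaban1988Convergent], [IV] = [Balaban1989LargeFieldI], [15] = [Balaban1985Variational].

WHAT THIS FILE PROVES (theorems only).
* §1 ★ THE GENERIC COMPOSITION at the all-numerics family: `exists_k0_of_thm1Scaled_theta13LiveOfNumerics` — K0‴(F) at ANY numerics `n` from `n.Pos`, `0 < ε₂₉`,
  (h15) and def-P11's three numerics clauses and two gauge clauses at the member `theta13LiveOfNumerics F 2 n ε₂₉ (ζ, Rz, Zt of record)` — nothing else.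
* §2 AT THE [15]-KEYED WITNESS `θ₁₅ = theta13OfThm1 F N ε₀ ε₂₉ B₃ a₀ a₁`: `hnum_theta13OfThm1`, `hBα_theta13OfThm1` (def-P11's numerics clauses are THEOREMS there,
  FILE 10a §2 + def-P11's `bg_numerics_of_letters`), ★★ `bg_theta13OfThm1_of_thm1Scaled (h15) (hloc) (h238)` (ROW P11 — the body of `θ₁₅.Provisos₁₃.bg` — with
  (hθ) ∕ (hRz) ∕ (ha₀) ∕ (hnum) ∕ (hBα) DISCHARGED), `provisos₁₃_theta13OfThm1_of_thm1Scaled`.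
* §3 ★★★ `exists_k0_of_thm1Scaled (F) (hε hε' hB ha₀ ha₁) (h15 : VariationalThm1Scaled F 2 B₃ a₀ a₁) (hloc) (h238) :
  ∃ θ : Stage13Params F 2, θ.Provisos₁₃ F 2 ∧ (θ.ZtUnity F 2 ∧ θ.SlotsNondegenerate₁₃ F 2) ∧ θ.Admissible F 2` — the K0‴ body for `F`: «∀ B₃ a₀ a₁, [15]-fact →
  (gauge clauses) → K0‴(F)», the closure shape node00-def-P11's FILE 2 header names; the witness is `θ₁₅`.

HONEST FRAMING.  A composition of tree theorems; CONDITIONAL on node00-def-P11's named fact `VariationalThm1Scaled` ([15] Thm 1 (8), per-scale reading — a `Prop`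
hypothesis, NEVER asserted) and on the two DISPLAYED gauge clauses ([15] Thm 1 (9)–(10) on print's cube class, hypotheses (hloc) ∕ (h238) verbatim from
`Stage13Params.bg_of_thm1Scaled` at `θ := θ₁₅`); nothing of Bałaban asserted; NOT a discharge; K0‴ NOT closed by this file (two displayed clauses + one named
fact remain); counts unmoved (typed 28∕28 · discharged 5∕28); one finite 𝕋⁴ programme at fixed ε — NOT continuum ∕ OS ∕ mass gap ∕ Clay.  No `sorry`, no `axiom`,
no `def`, no `instance`, no `notation`.
-/

noncomputable section

open MeasureTheory
open scoped Matrix.Norms.L2Operator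

namespace Literature.MathematicalPhysics.QuantumFieldTheory.Balaban1983to89.Node00

open T4Continuum B14.Eq218Concrete B15DeterminingSets B12RegularSpaces111 B14RegularSpaces234

/-! ## §1. ★ THE GENERIC COMPOSITION «socket ∘ supplier» at the all-numerics family: K0‴(F) at ANY numerics from (h15) + def-P11's displayed clauses -/

section Generic

/-- **★ K0‴(F) AT ANY NUMERICS `n` from `n.Pos`, `0 < ε₂₉`, [15] Thm 1 (8) (scaled reading, named fact) and node00-def-P11's five displayed clauses at the member
`θ = theta13LiveOfNumerics F 2 n ε₂₉ (ζ, Rz, Zt of record)`** — (ha₀) `εreg ≤ a₀`, (hnum), (hBα), (hloc) the (1.12) gauges, (h238) the (2.38) layer-cube gauges: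
FILE 9's socket `exists_k0_of_bg_theta13LiveOfNumerics` composed with def-P11's supplier `Stage13Params.bg_of_thm1Scaled` (`hθ` = `admissible_…`, `hRz` = `rfl`).
A REDUCTION — nothing of Bałaban asserted. [cite: Balaban1988Convergent, Thm 1 p.262, (2.27)–(2.28) p.259, (2.34)–(2.41) p.261, (3.16)–(3.22) pp.268–269; Balaban1985Variational, Thm 1 (8)–(10) p.279; Balaban1987RG1, (1.11)–(1.16) p.262; Balaban1989LargeFieldI, (0.3)–(0.4) p.176] -/
theorem exists_k0_of_thm1Scaled_theta13LiveOfNumerics (F : T4Family) {n : Stage12Numerics} {ε₂₉ : ℝ} (hn : n.Pos) (hε' : 0 < ε₂₉)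
    {B₃ a₀ a₁ : ℝ} (h15 : VariationalThm1Scaled F 2 B₃ a₀ a₁) (ha₀ : n.ν.εreg ≤ a₀)
    (hnum : ∀ (p : B12.RunParams) (k : ℕ), k ≤ p.K →
      Step.InInterval n.γ k (gOfRecord₁₃ F 2 (theta13LiveOfNumerics F 2 n ε₂₉ (zeta316OfRecord F 2 n.ν n.τ9.M n.A₁) (RzOfRecord F 2) (ZtOfRecord F 2)) p) →
      ∀ m, m ≤ k →
      0 < n.s2.cR * epsOfRecord n.ν (gOfRecord₁₃ F 2 (theta13LiveOfNumerics F 2 n ε₂₉ (zeta316OfRecord F 2 n.ν n.τ9.M n.A₁) (RzOfRecord F 2) (ZtOfRecord F 2)) p) m ∧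
      n.s2.cR * epsOfRecord n.ν (gOfRecord₁₃ F 2 (theta13LiveOfNumerics F 2 n ε₂₉ (zeta316OfRecord F 2 n.ν n.τ9.M n.A₁) (RzOfRecord F 2) (ZtOfRecord F 2)) p) m ≤ a₁ ∧
      B₃ * (n.s2.cR * epsOfRecord n.ν (gOfRecord₁₃ F 2 (theta13LiveOfNumerics F 2 n ε₂₉ (zeta316OfRecord F 2 n.ν n.τ9.M n.A₁) (RzOfRecord F 2) (ZtOfRecord F 2)) p) m)
        ≤ n.ν.εreg)
    (hBα : ∀ (p : B12.RunParams) (k : ℕ), k ≤ p.K →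
      Step.InInterval n.γ k (gOfRecord₁₃ F 2 (theta13LiveOfNumerics F 2 n ε₂₉ (zeta316OfRecord F 2 n.ν n.τ9.M n.A₁) (RzOfRecord F 2) (ZtOfRecord F 2)) p) →
      ∀ m, 1 ≤ m → m ≤ k →
      B₃ * (n.s2.cR * epsOfRecord n.ν (gOfRecord₁₃ F 2 (theta13LiveOfNumerics F 2 n ε₂₉ (zeta316OfRecord F 2 n.ν n.τ9.M n.A₁) (RzOfRecord F 2) (ZtOfRecord F 2)) p) m) ≤
        (1 - n.s2.βc) * (lfOfRecord₁₂ F 2 (theta13LiveOfNumerics F 2 n ε₂₉ (zeta316OfRecord F 2 n.ν n.τ9.M n.A₁) (RzOfRecord F 2) (ZtOfRecord F 2)).toStage12Params).alpha0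
          (gOfRecord₁₃ F 2 (theta13LiveOfNumerics F 2 n ε₂₉ (zeta316OfRecord F 2 n.ν n.τ9.M n.A₁) (RzOfRecord F 2) (ZtOfRecord F 2)) p m))
    (hloc : ∀ (p : B12.RunParams) (k : ℕ), k ≤ p.K →
      Step.InInterval n.γ k (gOfRecord₁₃ F 2 (theta13LiveOfNumerics F 2 n ε₂₉ (zeta316OfRecord F 2 n.ν n.τ9.M n.A₁) (RzOfRecord F 2) (ZtOfRecord F 2)) p) →
      ∀ (s : SeqOfRecord F n.ν n.τ9.M
          (gOfRecord₁₃ F 2 (theta13LiveOfNumerics F 2 n ε₂₉ (zeta316OfRecord F 2 n.ν n.τ9.M n.A₁) (RzOfRecord F 2) (ZtOfRecord F 2)) p) p.K k)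
        (W : MSField (F.P p.K) (SU 2)),
      W ∈ suppOfRecord₁₃ F 2 (theta13LiveOfNumerics F 2 n ε₂₉ (zeta316OfRecord F 2 n.ν n.τ9.M n.A₁) (RzOfRecord F 2) (ZtOfRecord F 2)) p k s →
      W ∈ solvableDom (avOfRecord F 2 p.K) (regMSOfRecord F 2 n.ν p.K k s.Ω) (genSet s.Ω k) →
      ∀ j, 1 ≤ j → j ≤ k → ∀ X : (Sect2.domSys (F.P p.K) n.τ9.M j).Dom, Sect2.domSites (F.P p.K) n.τ9.M j X ⊆ s.Λ j →
      ∀ C ∈ Sect2.cubesI n.τ9.M j (Sect2.domSites (F.P p.K) n.τ9.M j X), ∃ u : Site (F.P p.K) 0 → (MatA 2)ˣ,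
        (∀ x, u x ∈ (B12RegularSpaces111SpecialUnitary.suModel 2).G) ∧ ∃ A : PBond (F.P p.K) 0 → MatA 2,
        (∀ bd ∈ C.bonds, gaugeU u (fun b' => ιSU 2 (UbgMSOfRecord F 2 n.ν n.τ9.M
            (gOfRecord₁₃ F 2 (theta13LiveOfNumerics F 2 n ε₂₉ (zeta316OfRecord F 2 n.ν n.τ9.M n.A₁) (RzOfRecord F 2) (ZtOfRecord F 2)) p) p.K k s W b')) bd =
          expI ((F.P p.K).eta j) (A bd)) ∧
        (∀ bd ∈ C.bonds, ‖A bd‖ < n.s2.cB * (lfOfRecord₁₂ F 2 (theta13LiveOfNumerics F 2 n ε₂₉ (zeta316OfRecord F 2 n.ν n.τ9.M n.A₁) (RzOfRecord F 2) (ZtOfRecord F 2)).toStage12Params).alpha0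
          (gOfRecord₁₃ F 2 (theta13LiveOfNumerics F 2 n ε₂₉ (zeta316OfRecord F 2 n.ν n.τ9.M n.A₁) (RzOfRecord F 2) (ZtOfRecord F 2)) p j)) ∧
        ∀ q ∈ C.dpairs, ‖grad ((F.P p.K).eta j) q.2.1 (fun y => A ⟨y, q.2.2⟩) q.1‖ < n.s2.cB * (lfOfRecord₁₂ F 2 (theta13LiveOfNumerics F 2 n ε₂₉ (zeta316OfRecord F 2 n.ν n.τ9.M n.A₁) (RzOfRecord F 2) (ZtOfRecord F 2)).toStage12Params).alpha0
          (gOfRecord₁₃ F 2 (theta13LiveOfNumerics F 2 n ε₂₉ (zeta316OfRecord F 2 n.ν n.τ9.M n.A₁) (RzOfRecord F 2) (ZtOfRecord F 2)) p j))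
    (h238 : ∀ (p : B12.RunParams) (k : ℕ), k ≤ p.K →
      Step.InInterval n.γ k (gOfRecord₁₃ F 2 (theta13LiveOfNumerics F 2 n ε₂₉ (zeta316OfRecord F 2 n.ν n.τ9.M n.A₁) (RzOfRecord F 2) (ZtOfRecord F 2)) p) →
      ∀ (s : SeqOfRecord F n.ν n.τ9.M
          (gOfRecord₁₃ F 2 (theta13LiveOfNumerics F 2 n ε₂₉ (zeta316OfRecord F 2 n.ν n.τ9.M n.A₁) (RzOfRecord F 2) (ZtOfRecord F 2)) p) p.K k)
        (W : MSField (F.P p.K) (SU 2)),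
      W ∈ suppOfRecord₁₃ F 2 (theta13LiveOfNumerics F 2 n ε₂₉ (zeta316OfRecord F 2 n.ν n.τ9.M n.A₁) (RzOfRecord F 2) (ZtOfRecord F 2)) p k s →
      W ∈ solvableDom (avOfRecord F 2 p.K) (regMSOfRecord F 2 n.ν p.K k s.Ω) (genSet s.Ω k) →
      ∀ j, 1 ≤ j → j ≤ k → ∀ X : (Sect2.domSys (F.P p.K) n.τ9.M j).Dom,
      Sect2.admB (F.P p.K) n.ν n.τ9.M
          (gOfRecord₁₃ F 2 (theta13LiveOfNumerics F 2 n ε₂₉ (zeta316OfRecord F 2 n.ν n.τ9.M n.A₁) (RzOfRecord F 2) (ZtOfRecord F 2)) p) s.Ω s.Λ j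
          (Sect2.domSites (F.P p.K) n.τ9.M j X) = true →
      CondII238 (B12RegularSpaces111SpecialUnitary.suModel 2)
        (Sect2.frameMS (Sect2.Residual.unit (F.P p.K) (MatA 2)) n.τ9.M j (Sect2.domSites (F.P p.K) n.τ9.M j X) s.Ω)
        (MSConsts.ofParams (F.P p.K) n.s2.βc n.s2.B n.s2.C n.s2.Mr j)
        (fun m => (lfOfRecord₁₂ F 2 (theta13LiveOfNumerics F 2 n ε₂₉ (zeta316OfRecord F 2 n.ν n.τ9.M n.A₁) (RzOfRecord F 2) (ZtOfRecord F 2)).toStage12Params).alpha0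
          (gOfRecord₁₃ F 2 (theta13LiveOfNumerics F 2 n ε₂₉ (zeta316OfRecord F 2 n.ν n.τ9.M n.A₁) (RzOfRecord F 2) (ZtOfRecord F 2)) p m))
        (fun b' => ιSU 2 (UbgMSOfRecord F 2 n.ν n.τ9.M
          (gOfRecord₁₃ F 2 (theta13LiveOfNumerics F 2 n ε₂₉ (zeta316OfRecord F 2 n.ν n.τ9.M n.A₁) (RzOfRecord F 2) (ZtOfRecord F 2)) p) p.K k s W b'))) :
    ∃ θ : Stage13Params F 2, θ.Provisos₁₃ F 2 ∧ (θ.ZtUnity F 2 ∧ θ.SlotsNondegenerate₁₃ F 2) ∧ θ.Admissible F 2 :=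
  exists_k0_of_bg_theta13LiveOfNumerics F hn hε'
    (Stage13Params.bg_of_thm1Scaled (theta13LiveOfNumerics F 2 n ε₂₉ (zeta316OfRecord F 2 n.ν n.τ9.M n.A₁) (RzOfRecord F 2) (ZtOfRecord F 2))
      (admissible_theta13LiveOfNumerics F 2 _ _ _ hn hε') rfl h15 ha₀ hnum hBα hloc h238)

end Generic

/-! ## §2. def-P11's numerics clauses and ROW P11 at the [15]-keyed witness `θ₁₅ = theta13OfThm1 F N ε₀ ε₂₉ B₃ a₀ a₁` (FILE 10a §3) -/

section Witness

variable {F : T4Family} {N : ℕ} [NeZero N] {ε₀ ε₂₉ B₃ a₀ a₁ : ℝ}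

/-- **def-P11's numerics clause (hnum) IS A THEOREM AT `θ₁₅`** along every windowed run. [cite: Balaban1988Convergent, (2.4) p.255, (2.12) p.256; Balaban1985Variational, Thm 1 (7)–(8) p.279] -/
theorem hnum_theta13OfThm1 (hB : 0 ≤ B₃) (ha₀ : 0 < a₀) (ha₁ : 0 < a₁) :
    ∀ (p : B12.RunParams) (n : ℕ), n ≤ p.K →
      Step.InInterval (theta13OfThm1 F N ε₀ ε₂₉ B₃ a₀ a₁).γ n (gOfRecord₁₃ F N (theta13OfThm1 F N ε₀ ε₂₉ B₃ a₀ a₁) p) → ∀ m, m ≤ n →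
      0 < (theta13OfThm1 F N ε₀ ε₂₉ B₃ a₀ a₁).s2.cR *
          epsOfRecord (theta13OfThm1 F N ε₀ ε₂₉ B₃ a₀ a₁).ν (gOfRecord₁₃ F N (theta13OfThm1 F N ε₀ ε₂₉ B₃ a₀ a₁) p) m ∧
      (theta13OfThm1 F N ε₀ ε₂₉ B₃ a₀ a₁).s2.cR *
          epsOfRecord (theta13OfThm1 F N ε₀ ε₂₉ B₃ a₀ a₁).ν (gOfRecord₁₃ F N (theta13OfThm1 F N ε₀ ε₂₉ B₃ a₀ a₁) p) m ≤ a₁ ∧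
      B₃ * ((theta13OfThm1 F N ε₀ ε₂₉ B₃ a₀ a₁).s2.cR *
          epsOfRecord (theta13OfThm1 F N ε₀ ε₂₉ B₃ a₀ a₁).ν (gOfRecord₁₃ F N (theta13OfThm1 F N ε₀ ε₂₉ B₃ a₀ a₁) p) m) ≤
        (theta13OfThm1 F N ε₀ ε₂₉ B₃ a₀ a₁).ν.εreg :=
  fun _ _ _ hw => numerics_thm1_of_inInterval hB ha₀ ha₁ (by norm_num : (1 / 2 : ℝ) < 1) hw

/-- **def-P11's letter inequality (hBα) IS A THEOREM AT `θ₁₅`** along every windowed run (`bg_numerics_of_letters` with `p₀ = 1 ≤ q₀ = 2`, `B₃·A₀ ≤ ¾·C₀`,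
`g_m² ≤ ¼ ≤ e⁻¹`). [cite: Balaban1988Convergent, (2.4) p.255, (2.28) p.259, (2.34) p.261] -/
theorem hBα_theta13OfThm1 (hB : 0 ≤ B₃) (ha₀ : 0 ≤ a₀) (ha₁ : 0 ≤ a₁) :
    ∀ (p : B12.RunParams) (n : ℕ), n ≤ p.K →
      Step.InInterval (theta13OfThm1 F N ε₀ ε₂₉ B₃ a₀ a₁).γ n (gOfRecord₁₃ F N (theta13OfThm1 F N ε₀ ε₂₉ B₃ a₀ a₁) p) → ∀ m, 1 ≤ m → m ≤ n →
      B₃ * ((theta13OfThm1 F N ε₀ ε₂₉ B₃ a₀ a₁).s2.cR *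
          epsOfRecord (theta13OfThm1 F N ε₀ ε₂₉ B₃ a₀ a₁).ν (gOfRecord₁₃ F N (theta13OfThm1 F N ε₀ ε₂₉ B₃ a₀ a₁) p) m) ≤
        (1 - (theta13OfThm1 F N ε₀ ε₂₉ B₃ a₀ a₁).s2.βc) *
          (lfOfRecord₁₂ F N (theta13OfThm1 F N ε₀ ε₂₉ B₃ a₀ a₁).toStage12Params).alpha0 (gOfRecord₁₃ F N (theta13OfThm1 F N ε₀ ε₂₉ B₃ a₀ a₁) p m) :=
  fun p n _ hw =>
    (theta13OfThm1 F N ε₀ ε₂₉ B₃ a₀ a₁).bg_numerics_of_letters (by rw [theta13OfThm1_p₀, lfOfRecord₁₂_theta13OfThm1]; norm_num [lfConstsOfFamily, lfConstsOfRecord₁₂])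
      (mul_A0_nonneg_thm1 hB ha₀ ha₁) (mul_A0_le_C₀_thm1 hB) p n (window_sq_le_of_inInterval (theta13OfThm1_γ F N ε₀ ε₂₉ B₃ a₀ a₁).le hw)

/-- **★★ ROW P11 AT THE [15]-KEYED WITNESS — the BODY of `θ₁₅.Provisos₁₃.bg` — from (h15) [15] Thm 1 (8) (scaled reading) and the two DISPLAYED gauge clauses
(hloc) (1.12) [I] ∕ (h238) (2.38) [III] = [15] Thm 1 (9)–(10) ALONE**: node00-def-P11's `Stage13Params.bg_of_thm1Scaled` with (hθ) ∕ (hRz) ∕ (ha₀) ∕ (hnum) ∕ (hBα)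
discharged at `θ₁₅` under the signs `0 < ε₀`, `0 < ε₂₉`, `0 ≤ B₃`, `0 < a₀`, `0 < a₁`.  CONDITIONAL on the named fact; nothing of Bałaban asserted.
[cite: Balaban1988Convergent, (2.27)–(2.28) p.259, (2.34)–(2.41) p.261; Balaban1985Variational, Thm 1 (8)–(10) p.279; Balaban1987RG1, (1.11)–(1.16) p.262] -/
theorem bg_theta13OfThm1_of_thm1Scaled (hε : 0 < ε₀) (hε' : 0 < ε₂₉) (hB : 0 ≤ B₃) (ha₀ : 0 < a₀) (ha₁ : 0 < a₁)
    (h15 : VariationalThm1Scaled F N B₃ a₀ a₁)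
    (hloc : ∀ (p : B12.RunParams) (n : ℕ), n ≤ p.K →
      Step.InInterval (theta13OfThm1 F N ε₀ ε₂₉ B₃ a₀ a₁).γ n (gOfRecord₁₃ F N (theta13OfThm1 F N ε₀ ε₂₉ B₃ a₀ a₁) p) →
      ∀ (s : SeqOfRecord F (theta13OfThm1 F N ε₀ ε₂₉ B₃ a₀ a₁).ν (theta13OfThm1 F N ε₀ ε₂₉ B₃ a₀ a₁).τ9.M
          (gOfRecord₁₃ F N (theta13OfThm1 F N ε₀ ε₂₉ B₃ a₀ a₁) p) p.K n) (W : MSField (F.P p.K) (SU N)),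
      W ∈ suppOfRecord₁₃ F N (theta13OfThm1 F N ε₀ ε₂₉ B₃ a₀ a₁) p n s →
      W ∈ solvableDom (avOfRecord F N p.K) (regMSOfRecord F N (theta13OfThm1 F N ε₀ ε₂₉ B₃ a₀ a₁).ν p.K n s.Ω) (genSet s.Ω n) →
      ∀ j, 1 ≤ j → j ≤ n → ∀ X : (Sect2.domSys (F.P p.K) (theta13OfThm1 F N ε₀ ε₂₉ B₃ a₀ a₁).τ9.M j).Dom,
      Sect2.domSites (F.P p.K) (theta13OfThm1 F N ε₀ ε₂₉ B₃ a₀ a₁).τ9.M j X ⊆ s.Λ j →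
      ∀ C ∈ Sect2.cubesI (theta13OfThm1 F N ε₀ ε₂₉ B₃ a₀ a₁).τ9.M j (Sect2.domSites (F.P p.K) (theta13OfThm1 F N ε₀ ε₂₉ B₃ a₀ a₁).τ9.M j X),
      ∃ u : Site (F.P p.K) 0 → (MatA N)ˣ,
        (∀ x, u x ∈ (B12RegularSpaces111SpecialUnitary.suModel N).G) ∧ ∃ A : PBond (F.P p.K) 0 → MatA N,
        (∀ bd ∈ C.bonds, gaugeU u (fun b' => ιSU N (UbgMSOfRecord F N (theta13OfThm1 F N ε₀ ε₂₉ B₃ a₀ a₁).ν (theta13OfThm1 F N ε₀ ε₂₉ B₃ a₀ a₁).τ9.M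
            (gOfRecord₁₃ F N (theta13OfThm1 F N ε₀ ε₂₉ B₃ a₀ a₁) p) p.K n s W b')) bd = expI ((F.P p.K).eta j) (A bd)) ∧
        (∀ bd ∈ C.bonds, ‖A bd‖ < (theta13OfThm1 F N ε₀ ε₂₉ B₃ a₀ a₁).s2.cB *
          (lfOfRecord₁₂ F N (theta13OfThm1 F N ε₀ ε₂₉ B₃ a₀ a₁).toStage12Params).alpha0 (gOfRecord₁₃ F N (theta13OfThm1 F N ε₀ ε₂₉ B₃ a₀ a₁) p j)) ∧
        ∀ q ∈ C.dpairs, ‖grad ((F.P p.K).eta j) q.2.1 (fun y => A ⟨y, q.2.2⟩) q.1‖ < (theta13OfThm1 F N ε₀ ε₂₉ B₃ a₀ a₁).s2.cB *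
          (lfOfRecord₁₂ F N (theta13OfThm1 F N ε₀ ε₂₉ B₃ a₀ a₁).toStage12Params).alpha0 (gOfRecord₁₃ F N (theta13OfThm1 F N ε₀ ε₂₉ B₃ a₀ a₁) p j))
    (h238 : ∀ (p : B12.RunParams) (n : ℕ), n ≤ p.K →
      Step.InInterval (theta13OfThm1 F N ε₀ ε₂₉ B₃ a₀ a₁).γ n (gOfRecord₁₃ F N (theta13OfThm1 F N ε₀ ε₂₉ B₃ a₀ a₁) p) →
      ∀ (s : SeqOfRecord F (theta13OfThm1 F N ε₀ ε₂₉ B₃ a₀ a₁).ν (theta13OfThm1 F N ε₀ ε₂₉ B₃ a₀ a₁).τ9.M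
          (gOfRecord₁₃ F N (theta13OfThm1 F N ε₀ ε₂₉ B₃ a₀ a₁) p) p.K n) (W : MSField (F.P p.K) (SU N)),
      W ∈ suppOfRecord₁₃ F N (theta13OfThm1 F N ε₀ ε₂₉ B₃ a₀ a₁) p n s →
      W ∈ solvableDom (avOfRecord F N p.K) (regMSOfRecord F N (theta13OfThm1 F N ε₀ ε₂₉ B₃ a₀ a₁).ν p.K n s.Ω) (genSet s.Ω n) →
      ∀ j, 1 ≤ j → j ≤ n → ∀ X : (Sect2.domSys (F.P p.K) (theta13OfThm1 F N ε₀ ε₂₉ B₃ a₀ a₁).τ9.M j).Dom,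
      Sect2.admB (F.P p.K) (theta13OfThm1 F N ε₀ ε₂₉ B₃ a₀ a₁).ν (theta13OfThm1 F N ε₀ ε₂₉ B₃ a₀ a₁).τ9.M
          (gOfRecord₁₃ F N (theta13OfThm1 F N ε₀ ε₂₉ B₃ a₀ a₁) p) s.Ω s.Λ j (Sect2.domSites (F.P p.K) (theta13OfThm1 F N ε₀ ε₂₉ B₃ a₀ a₁).τ9.M j X) = true →
      CondII238 (B12RegularSpaces111SpecialUnitary.suModel N)
        (Sect2.frameMS (Sect2.Residual.unit (F.P p.K) (MatA N)) (theta13OfThm1 F N ε₀ ε₂₉ B₃ a₀ a₁).τ9.M j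
          (Sect2.domSites (F.P p.K) (theta13OfThm1 F N ε₀ ε₂₉ B₃ a₀ a₁).τ9.M j X) s.Ω)
        (MSConsts.ofParams (F.P p.K) (theta13OfThm1 F N ε₀ ε₂₉ B₃ a₀ a₁).s2.βc (theta13OfThm1 F N ε₀ ε₂₉ B₃ a₀ a₁).s2.B
          (theta13OfThm1 F N ε₀ ε₂₉ B₃ a₀ a₁).s2.C (theta13OfThm1 F N ε₀ ε₂₉ B₃ a₀ a₁).s2.Mr j)
        (fun m => (lfOfRecord₁₂ F N (theta13OfThm1 F N ε₀ ε₂₉ B₃ a₀ a₁).toStage12Params).alpha0 (gOfRecord₁₃ F N (theta13OfThm1 F N ε₀ ε₂₉ B₃ a₀ a₁) p m))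
        (fun b' => ιSU N (UbgMSOfRecord F N (theta13OfThm1 F N ε₀ ε₂₉ B₃ a₀ a₁).ν (theta13OfThm1 F N ε₀ ε₂₉ B₃ a₀ a₁).τ9.M
          (gOfRecord₁₃ F N (theta13OfThm1 F N ε₀ ε₂₉ B₃ a₀ a₁) p) p.K n s W b'))) :
    ∀ (p : B12.RunParams) (n : ℕ), n ≤ p.K →
      Step.InInterval (theta13OfThm1 F N ε₀ ε₂₉ B₃ a₀ a₁).γ n (gOfRecord₁₃ F N (theta13OfThm1 F N ε₀ ε₂₉ B₃ a₀ a₁) p) →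
      BgProvisoΛ F N p.K (settingOfRecord₁₃ F N (theta13OfThm1 F N ε₀ ε₂₉ B₃ a₀ a₁) p) ((theta13OfThm1 F N ε₀ ε₂₉ B₃ a₀ a₁).Rz p.K)
        (theta13OfThm1 F N ε₀ ε₂₉ B₃ a₀ a₁).τ9.M n (suppOfRecord₁₃ F N (theta13OfThm1 F N ε₀ ε₂₉ B₃ a₀ a₁) p n)
        (UbgOfRecord₁₃ F N (theta13OfThm1 F N ε₀ ε₂₉ B₃ a₀ a₁) p n) :=
  (theta13OfThm1 F N ε₀ ε₂₉ B₃ a₀ a₁).bg_of_thm1Scaled (admissible_theta13OfThm1 F N hε hε' hB ha₀ ha₁) rfl h15 (theta13OfThm1_εreg F N ε₀ ε₂₉ B₃ a₀ a₁).le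
    (hnum_theta13OfThm1 hB ha₀ ha₁) (hBα_theta13OfThm1 hB ha₀.le ha₁.le) hloc h238

/-- **★★ `Provisos₁₃` AT `θ₁₅` from (h15) and the two gauge clauses ALONE** (FILE 9's `provisos₁₃_theta13LiveOfNumerics_of_bg`; (H-U) by K0c's `localBgMeasurable`).
[cite: Balaban1988Convergent, (2.18) p.257, (2.28) p.259, (3.16) p.268, (3.22) p.269; Balaban1985Variational, Thm 1 (8)–(10) p.279; Balaban1989LargeFieldI, (0.3)–(0.4) p.176 (bookkeeping)] -/
theorem provisos₁₃_theta13OfThm1_of_thm1Scaled (hε : 0 < ε₀) (hε' : 0 < ε₂₉) (hB : 0 ≤ B₃) (ha₀ : 0 < a₀) (ha₁ : 0 < a₁)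
    (h15 : VariationalThm1Scaled F N B₃ a₀ a₁)
    (hloc : ∀ (p : B12.RunParams) (n : ℕ), n ≤ p.K →
      Step.InInterval (theta13OfThm1 F N ε₀ ε₂₉ B₃ a₀ a₁).γ n (gOfRecord₁₃ F N (theta13OfThm1 F N ε₀ ε₂₉ B₃ a₀ a₁) p) →
      ∀ (s : SeqOfRecord F (theta13OfThm1 F N ε₀ ε₂₉ B₃ a₀ a₁).ν (theta13OfThm1 F N ε₀ ε₂₉ B₃ a₀ a₁).τ9.M
          (gOfRecord₁₃ F N (theta13OfThm1 F N ε₀ ε₂₉ B₃ a₀ a₁) p) p.K n) (W : MSField (F.P p.K) (SU N)),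
      W ∈ suppOfRecord₁₃ F N (theta13OfThm1 F N ε₀ ε₂₉ B₃ a₀ a₁) p n s →
      W ∈ solvableDom (avOfRecord F N p.K) (regMSOfRecord F N (theta13OfThm1 F N ε₀ ε₂₉ B₃ a₀ a₁).ν p.K n s.Ω) (genSet s.Ω n) →
      ∀ j, 1 ≤ j → j ≤ n → ∀ X : (Sect2.domSys (F.P p.K) (theta13OfThm1 F N ε₀ ε₂₉ B₃ a₀ a₁).τ9.M j).Dom,
      Sect2.domSites (F.P p.K) (theta13OfThm1 F N ε₀ ε₂₉ B₃ a₀ a₁).τ9.M j X ⊆ s.Λ j →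
      ∀ C ∈ Sect2.cubesI (theta13OfThm1 F N ε₀ ε₂₉ B₃ a₀ a₁).τ9.M j (Sect2.domSites (F.P p.K) (theta13OfThm1 F N ε₀ ε₂₉ B₃ a₀ a₁).τ9.M j X),
      ∃ u : Site (F.P p.K) 0 → (MatA N)ˣ,
        (∀ x, u x ∈ (B12RegularSpaces111SpecialUnitary.suModel N).G) ∧ ∃ A : PBond (F.P p.K) 0 → MatA N,
        (∀ bd ∈ C.bonds, gaugeU u (fun b' => ιSU N (UbgMSOfRecord F N (theta13OfThm1 F N ε₀ ε₂₉ B₃ a₀ a₁).ν (theta13OfThm1 F N ε₀ ε₂₉ B₃ a₀ a₁).τ9.M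
            (gOfRecord₁₃ F N (theta13OfThm1 F N ε₀ ε₂₉ B₃ a₀ a₁) p) p.K n s W b')) bd = expI ((F.P p.K).eta j) (A bd)) ∧
        (∀ bd ∈ C.bonds, ‖A bd‖ < (theta13OfThm1 F N ε₀ ε₂₉ B₃ a₀ a₁).s2.cB *
          (lfOfRecord₁₂ F N (theta13OfThm1 F N ε₀ ε₂₉ B₃ a₀ a₁).toStage12Params).alpha0 (gOfRecord₁₃ F N (theta13OfThm1 F N ε₀ ε₂₉ B₃ a₀ a₁) p j)) ∧
        ∀ q ∈ C.dpairs, ‖grad ((F.P p.K).eta j) q.2.1 (fun y => A ⟨y, q.2.2⟩) q.1‖ < (theta13OfThm1 F N ε₀ ε₂₉ B₃ a₀ a₁).s2.cB *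
          (lfOfRecord₁₂ F N (theta13OfThm1 F N ε₀ ε₂₉ B₃ a₀ a₁).toStage12Params).alpha0 (gOfRecord₁₃ F N (theta13OfThm1 F N ε₀ ε₂₉ B₃ a₀ a₁) p j))
    (h238 : ∀ (p : B12.RunParams) (n : ℕ), n ≤ p.K →
      Step.InInterval (theta13OfThm1 F N ε₀ ε₂₉ B₃ a₀ a₁).γ n (gOfRecord₁₃ F N (theta13OfThm1 F N ε₀ ε₂₉ B₃ a₀ a₁) p) →
      ∀ (s : SeqOfRecord F (theta13OfThm1 F N ε₀ ε₂₉ B₃ a₀ a₁).ν (theta13OfThm1 F N ε₀ ε₂₉ B₃ a₀ a₁).τ9.M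
          (gOfRecord₁₃ F N (theta13OfThm1 F N ε₀ ε₂₉ B₃ a₀ a₁) p) p.K n) (W : MSField (F.P p.K) (SU N)),
      W ∈ suppOfRecord₁₃ F N (theta13OfThm1 F N ε₀ ε₂₉ B₃ a₀ a₁) p n s →
      W ∈ solvableDom (avOfRecord F N p.K) (regMSOfRecord F N (theta13OfThm1 F N ε₀ ε₂₉ B₃ a₀ a₁).ν p.K n s.Ω) (genSet s.Ω n) →
      ∀ j, 1 ≤ j → j ≤ n → ∀ X : (Sect2.domSys (F.P p.K) (theta13OfThm1 F N ε₀ ε₂₉ B₃ a₀ a₁).τ9.M j).Dom,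
      Sect2.admB (F.P p.K) (theta13OfThm1 F N ε₀ ε₂₉ B₃ a₀ a₁).ν (theta13OfThm1 F N ε₀ ε₂₉ B₃ a₀ a₁).τ9.M
          (gOfRecord₁₃ F N (theta13OfThm1 F N ε₀ ε₂₉ B₃ a₀ a₁) p) s.Ω s.Λ j (Sect2.domSites (F.P p.K) (theta13OfThm1 F N ε₀ ε₂₉ B₃ a₀ a₁).τ9.M j X) = true →
      CondII238 (B12RegularSpaces111SpecialUnitary.suModel N)
        (Sect2.frameMS (Sect2.Residual.unit (F.P p.K) (MatA N)) (theta13OfThm1 F N ε₀ ε₂₉ B₃ a₀ a₁).τ9.M j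
          (Sect2.domSites (F.P p.K) (theta13OfThm1 F N ε₀ ε₂₉ B₃ a₀ a₁).τ9.M j X) s.Ω)
        (MSConsts.ofParams (F.P p.K) (theta13OfThm1 F N ε₀ ε₂₉ B₃ a₀ a₁).s2.βc (theta13OfThm1 F N ε₀ ε₂₉ B₃ a₀ a₁).s2.B
          (theta13OfThm1 F N ε₀ ε₂₉ B₃ a₀ a₁).s2.C (theta13OfThm1 F N ε₀ ε₂₉ B₃ a₀ a₁).s2.Mr j)
        (fun m => (lfOfRecord₁₂ F N (theta13OfThm1 F N ε₀ ε₂₉ B₃ a₀ a₁).toStage12Params).alpha0 (gOfRecord₁₃ F N (theta13OfThm1 F N ε₀ ε₂₉ B₃ a₀ a₁) p m))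
        (fun b' => ιSU N (UbgMSOfRecord F N (theta13OfThm1 F N ε₀ ε₂₉ B₃ a₀ a₁).ν (theta13OfThm1 F N ε₀ ε₂₉ B₃ a₀ a₁).τ9.M
          (gOfRecord₁₃ F N (theta13OfThm1 F N ε₀ ε₂₉ B₃ a₀ a₁) p) p.K n s W b'))) :
    (theta13OfThm1 F N ε₀ ε₂₉ B₃ a₀ a₁).Provisos₁₃ F N :=
  provisos₁₃_theta13LiveOfNumerics_of_bg F N (stage12NumericsOfThm1 ε₀ B₃ a₀ a₁) ε₂₉ (bg_theta13OfThm1_of_thm1Scaled hε hε' hB ha₀ ha₁ h15 hloc h238)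

end Witness

/-! ## §3. ★★★ K0‴(F) from [15] Theorem 1 — (8) as the named fact, (9)–(10) as the two displayed gauge clauses — at the [15]-keyed witness -/

section Closure

/-- **★★★ THE K0‴ BODY FOR `F` AT `N = 2` FROM [15] THEOREM 1 ALONE — (8) as the named fact `VariationalThm1Scaled F 2 B₃ a₀ a₁` (per-scale reading), (9)–(10)
as the two displayed gauge clauses at the [15]-keyed witness `θ₁₅(ε₀, ε₂₉; B₃, a₀, a₁)` — under the signs `0 < ε₀`, `0 < ε₂₉`, `0 ≤ B₃`, `0 < a₀`, `0 < a₁`**: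
every other row of `Provisos₁₃`, `ZtUnity`, `SlotsNondegenerate₁₃`, `Admissible` and node00-def-P11's numerics clauses are THEOREMS at `θ₁₅`.  The closure shape
«∀ B₃ a₀ a₁, [15]-fact → (gauge clauses) → K0‴(F)»; CONDITIONAL — nothing of Bałaban asserted; K0‴ NOT closed here.
[cite: Balaban1988Convergent, Thm 1 p.262, (2.7) p.255, (2.27)–(2.28) p.259, (2.34)–(2.41) p.261, (3.16)–(3.22) pp.268–269; Balaban1985Variational, Thm 1 (8)–(10) p.279; Balaban1987RG1, (1.11)–(1.16) p.262; Balaban1989LargeFieldI, (0.3)–(0.4) p.176] -/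
theorem exists_k0_of_thm1Scaled (F : T4Family) {ε₀ ε₂₉ B₃ a₀ a₁ : ℝ} (hε : 0 < ε₀) (hε' : 0 < ε₂₉) (hB : 0 ≤ B₃) (ha₀ : 0 < a₀) (ha₁ : 0 < a₁)
    (h15 : VariationalThm1Scaled F 2 B₃ a₀ a₁)
    (hloc : ∀ (p : B12.RunParams) (n : ℕ), n ≤ p.K →
      Step.InInterval (theta13OfThm1 F 2 ε₀ ε₂₉ B₃ a₀ a₁).γ n (gOfRecord₁₃ F 2 (theta13OfThm1 F 2 ε₀ ε₂₉ B₃ a₀ a₁) p) →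
      ∀ (s : SeqOfRecord F (theta13OfThm1 F 2 ε₀ ε₂₉ B₃ a₀ a₁).ν (theta13OfThm1 F 2 ε₀ ε₂₉ B₃ a₀ a₁).τ9.M
          (gOfRecord₁₃ F 2 (theta13OfThm1 F 2 ε₀ ε₂₉ B₃ a₀ a₁) p) p.K n) (W : MSField (F.P p.K) (SU 2)),
      W ∈ suppOfRecord₁₃ F 2 (theta13OfThm1 F 2 ε₀ ε₂₉ B₃ a₀ a₁) p n s →
      W ∈ solvableDom (avOfRecord F 2 p.K) (regMSOfRecord F 2 (theta13OfThm1 F 2 ε₀ ε₂₉ B₃ a₀ a₁).ν p.K n s.Ω) (genSet s.Ω n) →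
      ∀ j, 1 ≤ j → j ≤ n → ∀ X : (Sect2.domSys (F.P p.K) (theta13OfThm1 F 2 ε₀ ε₂₉ B₃ a₀ a₁).τ9.M j).Dom,
      Sect2.domSites (F.P p.K) (theta13OfThm1 F 2 ε₀ ε₂₉ B₃ a₀ a₁).τ9.M j X ⊆ s.Λ j →
      ∀ C ∈ Sect2.cubesI (theta13OfThm1 F 2 ε₀ ε₂₉ B₃ a₀ a₁).τ9.M j (Sect2.domSites (F.P p.K) (theta13OfThm1 F 2 ε₀ ε₂₉ B₃ a₀ a₁).τ9.M j X),
      ∃ u : Site (F.P p.K) 0 → (MatA 2)ˣ,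
        (∀ x, u x ∈ (B12RegularSpaces111SpecialUnitary.suModel 2).G) ∧ ∃ A : PBond (F.P p.K) 0 → MatA 2,
        (∀ bd ∈ C.bonds, gaugeU u (fun b' => ιSU 2 (UbgMSOfRecord F 2 (theta13OfThm1 F 2 ε₀ ε₂₉ B₃ a₀ a₁).ν (theta13OfThm1 F 2 ε₀ ε₂₉ B₃ a₀ a₁).τ9.M
            (gOfRecord₁₃ F 2 (theta13OfThm1 F 2 ε₀ ε₂₉ B₃ a₀ a₁) p) p.K n s W b')) bd = expI ((F.P p.K).eta j) (A bd)) ∧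
        (∀ bd ∈ C.bonds, ‖A bd‖ < (theta13OfThm1 F 2 ε₀ ε₂₉ B₃ a₀ a₁).s2.cB *
          (lfOfRecord₁₂ F 2 (theta13OfThm1 F 2 ε₀ ε₂₉ B₃ a₀ a₁).toStage12Params).alpha0 (gOfRecord₁₃ F 2 (theta13OfThm1 F 2 ε₀ ε₂₉ B₃ a₀ a₁) p j)) ∧
        ∀ q ∈ C.dpairs, ‖grad ((F.P p.K).eta j) q.2.1 (fun y => A ⟨y, q.2.2⟩) q.1‖ < (theta13OfThm1 F 2 ε₀ ε₂₉ B₃ a₀ a₁).s2.cB *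
          (lfOfRecord₁₂ F 2 (theta13OfThm1 F 2 ε₀ ε₂₉ B₃ a₀ a₁).toStage12Params).alpha0 (gOfRecord₁₃ F 2 (theta13OfThm1 F 2 ε₀ ε₂₉ B₃ a₀ a₁) p j))
    (h238 : ∀ (p : B12.RunParams) (n : ℕ), n ≤ p.K →
      Step.InInterval (theta13OfThm1 F 2 ε₀ ε₂₉ B₃ a₀ a₁).γ n (gOfRecord₁₃ F 2 (theta13OfThm1 F 2 ε₀ ε₂₉ B₃ a₀ a₁) p) →
      ∀ (s : SeqOfRecord F (theta13OfThm1 F 2 ε₀ ε₂₉ B₃ a₀ a₁).ν (theta13OfThm1 F 2 ε₀ ε₂₉ B₃ a₀ a₁).τ9.M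
          (gOfRecord₁₃ F 2 (theta13OfThm1 F 2 ε₀ ε₂₉ B₃ a₀ a₁) p) p.K n) (W : MSField (F.P p.K) (SU 2)),
      W ∈ suppOfRecord₁₃ F 2 (theta13OfThm1 F 2 ε₀ ε₂₉ B₃ a₀ a₁) p n s →
      W ∈ solvableDom (avOfRecord F 2 p.K) (regMSOfRecord F 2 (theta13OfThm1 F 2 ε₀ ε₂₉ B₃ a₀ a₁).ν p.K n s.Ω) (genSet s.Ω n) →
      ∀ j, 1 ≤ j → j ≤ n → ∀ X : (Sect2.domSys (F.P p.K) (theta13OfThm1 F 2 ε₀ ε₂₉ B₃ a₀ a₁).τ9.M j).Dom,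
      Sect2.admB (F.P p.K) (theta13OfThm1 F 2 ε₀ ε₂₉ B₃ a₀ a₁).ν (theta13OfThm1 F 2 ε₀ ε₂₉ B₃ a₀ a₁).τ9.M
          (gOfRecord₁₃ F 2 (theta13OfThm1 F 2 ε₀ ε₂₉ B₃ a₀ a₁) p) s.Ω s.Λ j (Sect2.domSites (F.P p.K) (theta13OfThm1 F 2 ε₀ ε₂₉ B₃ a₀ a₁).τ9.M j X) = true →
      CondII238 (B12RegularSpaces111SpecialUnitary.suModel 2)
        (Sect2.frameMS (Sect2.Residual.unit (F.P p.K) (MatA 2)) (theta13OfThm1 F 2 ε₀ ε₂₉ B₃ a₀ a₁).τ9.M j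
          (Sect2.domSites (F.P p.K) (theta13OfThm1 F 2 ε₀ ε₂₉ B₃ a₀ a₁).τ9.M j X) s.Ω)
        (MSConsts.ofParams (F.P p.K) (theta13OfThm1 F 2 ε₀ ε₂₉ B₃ a₀ a₁).s2.βc (theta13OfThm1 F 2 ε₀ ε₂₉ B₃ a₀ a₁).s2.B
          (theta13OfThm1 F 2 ε₀ ε₂₉ B₃ a₀ a₁).s2.C (theta13OfThm1 F 2 ε₀ ε₂₉ B₃ a₀ a₁).s2.Mr j)
        (fun m => (lfOfRecord₁₂ F 2 (theta13OfThm1 F 2 ε₀ ε₂₉ B₃ a₀ a₁).toStage12Params).alpha0 (gOfRecord₁₃ F 2 (theta13OfThm1 F 2 ε₀ ε₂₉ B₃ a₀ a₁) p m))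
        (fun b' => ιSU 2 (UbgMSOfRecord F 2 (theta13OfThm1 F 2 ε₀ ε₂₉ B₃ a₀ a₁).ν (theta13OfThm1 F 2 ε₀ ε₂₉ B₃ a₀ a₁).τ9.M
          (gOfRecord₁₃ F 2 (theta13OfThm1 F 2 ε₀ ε₂₉ B₃ a₀ a₁) p) p.K n s W b'))) :
    ∃ θ : Stage13Params F 2, θ.Provisos₁₃ F 2 ∧ (θ.ZtUnity F 2 ∧ θ.SlotsNondegenerate₁₃ F 2) ∧ θ.Admissible F 2 :=
  have hP := provisos₁₃_theta13OfThm1_of_thm1Scaled hε hε' hB ha₀ ha₁ h15 hloc h238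
  ⟨theta13OfThm1 F 2 ε₀ ε₂₉ B₃ a₀ a₁, hP, ⟨ztUnity_theta13OfThm1 F 2 ε₀ ε₂₉ B₃ a₀ a₁, slotsNondegenerate₁₃_theta13OfThm1 F 2 ε₀ ε₂₉ B₃ a₀ a₁ hP⟩,
    admissible_theta13OfThm1 F 2 hε hε' hB ha₀ ha₁⟩

end Closure

end Literature.MathematicalPhysics.QuantumFieldTheory.Balaban1983to89.Node00

end
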